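import Literature.Barriers.AnomalousDissipation.ObukhovCorrsinThreshold
import Literature.Analysis.FluidPDE.PassiveScalarHolderSlice
import Literature.Analysis.FluidPDE.PassiveScalarEnergyMollified
import HarnessLib

/-!
# Discharge of the Obukhov–Corrsin threshold (Drivas–Elgindi–Iyer–Jeong 2022, Thm. 4)

Proof file for the named fact
`Literature.Barriers.AnomalousDissipation.DrivasElgindiIyerJeong2022_thm4`
(`Barriers/AnomalousDissipation/ObukhovCorrsinThreshold`): for a divergence-free
`u ∈ L¹(0,T; C^α(T^d))`, a datum `θ₀ ∈ C^β`, `0 < κ ≤ κ₀`, and a weak solution `θ` of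
`∂ₜθ + u·∇θ = κΔθ` on `T^d × [0,T)` obeying the energy balance and bounded in `L^∞(0,T; C^β)`,
`κ ∫₀ᵀ ‖∇θ‖²_{L²} ≤ C κ^{(α+2β-1)/(α+1)}` with `C = C(d, T, α, β, K, M, κ₀)`
(Drivas–Elgindi–Iyer–Jeong, ARMA 243 (2022), Thm. 4, first assertion; proof §5, (5.8)–(5.10),
arXiv numbering). The statement was found faithful as vendored.

## Proof (the printed one, (5.8)–(5.10), in the a.e.-in-time form of the tree's weak solutions)

Mollify in space with `k = kernel ε` (`A = θ ⋆ k`). For a.e. `t ∈ (0,T)`: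
* the energy hypothesis (1.2) and Young's inequality `‖θ(t) ⋆ k‖₂ ≤ ‖θ(t)‖₂` give
  `2κ∫₀ᵗ‖∇θ‖² ≤ ‖θ₀‖²₂ - ‖A(t)‖²₂`;
* the mollified energy identity with datum
  (`IsWeakScalarTransportOn.ae_integral_sq_molInt_eq`, `PassiveScalarEnergyMollified`):
  `‖A(t)‖² = ‖θ₀ ⋆ k‖² + 2∫₀ᵗ ∫ A G`, `G` the flux of the mollified equation (5.8);
* the slice bound in Hölder classes (`Torus.neg_integral_conv_mul_flux_le_of_holderWith`,
  `PassiveScalarHolderSlice`; this is (5.9)–(5.10): the commutator form of the flux, the CET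
  sup-norm estimates `|∇θ̄_ℓ| ≤ C₁ [θ]_β ℓ^{β-1}`, `|τ_ℓ| ≤ 2[u]_α[θ]_β ℓ^{α+β}`):
  `-∫ A G ≤ 2 d C₁ [θ]²_β [u(s)]_α ε^{α+2β-1} + κ d C₁² [θ]²_β ε^{2β-2}` for a.e. `s`;
* the cumulant bound `‖θ₀‖² - ‖θ₀ ⋆ k‖² = ∫τ_ε(θ₀,θ₀) ≤ [θ₀]²_β ε^{2β}`
  (`Torus.integral_sq_sub_integral_convolution_sq_le`).
Integrating the slice bound in time against `∫₀ᵀ ‖u‖_{C^α} ≤ K` (in `ℝ≥0∞`, the map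
`s ↦ ‖u(s)‖_{C^α}` not being assumed measurable) gives, for a.e. `t` and then for `t = T`
(`setLIntegral_Ioo_le_of_ae_le`),
`2κ∫₀ᵀ‖∇θ‖² ≤ M²ε^{2β} + 4dC₁M²K ε^{α+2β-1} + 2dC₁²TM² κε^{2β-2}`
(`DrivasElgindiIyerJeong2022_thm4.two_mul_eScalarDissipation_le`), and the choice
`ε = ¼ (κ/κ₀)^{1/(α+1)}` ("optimizing `ℓ` as a function of `κ` we find `ℓ = κ^{1/(α+1)}`"; the
factor `¼κ₀^{-1/(α+1)}` keeps `ε ≤ ¼`, the admissible range of the torus mollifier) yields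
`C κ^{(α+2β-1)/(α+1)}` (`scale_bound`), using `κ^{2β/(α+1)} ≤ κ₀^{(1-α)/(α+1)} κ^{(α+2β-1)/(α+1)}`
for `κ ≤ κ₀`.

## Addendum (barrier audit 2026-08-17, gen 18)

`DrivasElgindiIyerJeong2022_thm4_allKappa`: on and above the Obukhov–Corrsin line, `1 ≤ α + 2β`, the
range proviso `κ ≤ κ₀` of the named fact is cosmetic — one constant `C = C(d, T, α, β, K, M)` serves
every `κ > 0` (the named fact at `κ₀ = 1` for `κ ≤ 1`; for `κ ≥ 1` the energy hypothesis alone gives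
`κ∫₀ᵀ‖∇θ‖²₂ ≤ ½‖θ₀‖²₂ ≤ ½M² ≤ ½M²κ^{(α+2β-1)/(α+1)}`, the exponent being non-negative). Below the
line the `κ₀`-dependence is genuine (heat flows; scope caveat (iv) of the block).

## References

* T. D. Drivas, T. M. Elgindi, G. Iyer, I.-J. Jeong, *Anomalous dissipation in passive scalar
  transport*, Arch. Ration. Mech. Anal. 243 (2022), 1151–1180 (arXiv:1911.03271), (1.1)–(1.2),
  Thm. 4 and its proof, §5, (5.8)–(5.10). Bib key `DrivasEtAl2022`.
* P. Constantin, W. E, E. S. Titi, Comm. Math. Phys. 165 (1994), 207–209, (6)–(11). Bib key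
  `ConstantinETiti1994`.
-/

open MeasureTheory Set Filter Topology
open scoped ENNReal NNReal Convolution InnerProductSpace

noncomputable section

namespace Literature.Barriers.AnomalousDissipation

open Literature.Analysis Literature.Analysis.FunctionSpaces Literature.Analysis.FluidPDE

/-! ## Two elementary lemmas -/

/-- **From a.e. times to the full interval, `lintegral` form**: if `∫⁻_{(0,t)} f ≤ R` for a.e.
`t ∈ (0,T)`, then `∫⁻_{(0,T)} f ≤ R` (there are good times `tₙ → T⁻`; `(0,T) = ⋃ₙ (0,tₙ)` is a
directed union and the set integral over a directed union is the supremum). [folklore] -/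
theorem setLIntegral_Ioo_le_of_ae_le {f : ℝ → ℝ≥0∞} {T : ℝ} (hT : 0 < T) {R : ℝ≥0∞}
    (h : ∀ᵐ t ∂((volume : Measure ℝ).restrict (Ioo 0 T)), ∫⁻ s in Ioo 0 t, f s ≤ R) :
    ∫⁻ s in Ioo 0 T, f s ≤ R := by
  -- good times `tₙ ∈ (max 0 (T - 1/(n+1)), T)`
  have hgood : ∀ n : ℕ, ∃ t ∈ Ioo (max 0 (T - 1 / ((n : ℝ) + 1))) T, ∫⁻ s in Ioo 0 t, f s ≤ R := by
    intro n
    set a : ℝ := max 0 (T - 1 / ((n : ℝ) + 1)) with ha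
    have haT : a < T := max_lt hT (by
      have : (0 : ℝ) < 1 / ((n : ℝ) + 1) := by positivity
      linarith)
    have hsub : Ioo a T ⊆ Ioo 0 T := Ioo_subset_Ioo_left (le_max_left _ _)
    have h' : ∀ᵐ t ∂((volume : Measure ℝ).restrict (Ioo a T)), t ∈ Ioo a T ∧ ∫⁻ s in Ioo 0 t, f s ≤ R :=
      (ae_restrict_mem measurableSet_Ioo).and (ae_restrict_of_ae_restrict_of_subset hsub h)
    haveI hne : (ae ((volume : Measure ℝ).restrict (Ioo a T))).NeBot := by
      rw [ae_neBot, Ne, Measure.restrict_eq_zero, Real.volume_Ioo, ENNReal.ofReal_eq_zero, not_le]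
      linarith
    obtain ⟨t, ht⟩ := h'.exists
    exact ⟨t, ht.1, ht.2⟩
  choose t ht hR using hgood
  -- `tₙ → T`
  have htT : Tendsto t atTop (𝓝 T) := by
    have hlow : Tendsto (fun n : ℕ => T - 1 / ((n : ℝ) + 1)) atTop (𝓝 T) := by
      have := (tendsto_one_div_add_atTop_nhds_zero_nat (𝕜 := ℝ)).const_sub T
      simpa using this
    exact tendsto_of_tendsto_of_tendsto_of_le_of_le hlow tendsto_const_nhds
      (fun n => ((le_max_right _ _).trans_lt (ht n).1).le) (fun n => (ht n).2.le)
  -- `(0,T) ⊆ ⋃ₙ (0,tₙ)`, a directed union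
  have hsub : Ioo 0 T ⊆ ⋃ n, Ioo 0 (t n) := by
    intro s hs
    obtain ⟨n, hn⟩ := (htT.eventually (Ioi_mem_nhds hs.2)).exists
    exact mem_iUnion.2 ⟨n, hs.1, hn⟩
  have hdir : Directed (· ⊆ ·) fun n => Ioo (0 : ℝ) (t n) := by
    intro m n
    obtain ⟨k, hk⟩ := (htT.eventually (Ioi_mem_nhds (max_lt (ht m).2 (ht n).2))).exists
    exact ⟨k, Ioo_subset_Ioo_right ((le_max_left _ _).trans (le_of_lt hk)),
      Ioo_subset_Ioo_right ((le_max_right _ _).trans (le_of_lt hk))⟩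
  calc ∫⁻ s in Ioo 0 T, f s ≤ ∫⁻ s in ⋃ n, Ioo 0 (t n), f s := lintegral_mono_set hsub
    _ = ⨆ n, ∫⁻ s in Ioo 0 (t n), f s := setLIntegral_iUnion_of_directed f hdir
    _ ≤ R := iSup_le hR

/-- **The scale optimisation** ("setting `t = 0` and optimizing `ℓ` as a function of `κ` we
find `ℓ = κ^{1/(α+1)}`", DEIJ 2022, proof of Thm. 4): with `ε = c κ^γ`, `γ = 1/(α+1)`,
`c > 0`, `0 < κ ≤ κ₀`, `α ≤ 1`, and `A ≥ 0`,
`A ε^{2β} + B ε^{α+2β-1} + D κ ε^{2β-2} ≤ (A c^{2β} κ₀^{(1-α)γ} + B c^{α+2β-1} + D c^{2β-2}) κ^{(α+2β-1)/(α+1)}`. [folklore] -/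
theorem scale_bound {α β κ κ₀ c γ A : ℝ} (B D : ℝ) (hα1 : α ≤ 1) (hαpos : 0 < α + 1)
    (hκ : 0 < κ) (hκ₀ : κ ≤ κ₀) (hc : 0 < c) (hγ : γ = (α + 1)⁻¹) (hA : 0 ≤ A) :
    A * (c * κ ^ γ) ^ (2 * β) + B * (c * κ ^ γ) ^ (α + 2 * β - 1) +
        D * (κ * (c * κ ^ γ) ^ (2 * β - 2)) ≤
      (A * (c ^ (2 * β) * κ₀ ^ ((1 - α) * γ)) + B * c ^ (α + 2 * β - 1) + D * c ^ (2 * β - 2)) *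
        κ ^ ((α + 2 * β - 1) / (α + 1)) := by
  have hκγ : 0 ≤ κ ^ γ := Real.rpow_nonneg hκ.le γ
  have hpow : ∀ p : ℝ, (c * κ ^ γ) ^ p = c ^ p * κ ^ (γ * p) := fun p => by
    rw [Real.mul_rpow hc.le hκγ, ← Real.rpow_mul hκ.le]
  set e : ℝ := (α + 2 * β - 1) / (α + 1) with he
  have hne : α + 1 ≠ 0 := hαpos.ne'
  have e1 : γ * (2 * β) = e + (1 - α) * γ := by rw [hγ, he]; field_simp; ring
  have e2 : γ * (α + 2 * β - 1) = e := by rw [hγ, he]; field_simp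
  have e3 : 1 + γ * (2 * β - 2) = e := by rw [hγ, he]; field_simp; ring
  have t1 : (c * κ ^ γ) ^ (2 * β) = c ^ (2 * β) * (κ ^ e * κ ^ ((1 - α) * γ)) := by
    rw [hpow, e1, Real.rpow_add hκ]
  have t2 : (c * κ ^ γ) ^ (α + 2 * β - 1) = c ^ (α + 2 * β - 1) * κ ^ e := by rw [hpow, e2]
  have t3 : κ * (c * κ ^ γ) ^ (2 * β - 2) = c ^ (2 * β - 2) * κ ^ e := by
    rw [hpow, ← e3, Real.rpow_add hκ, Real.rpow_one]; ring
  have hx : κ ^ ((1 - α) * γ) ≤ κ₀ ^ ((1 - α) * γ) :=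
    Real.rpow_le_rpow hκ.le hκ₀ (mul_nonneg (by linarith) (by rw [hγ]; positivity))
  rw [t1, t2, t3]
  have hκe : 0 ≤ κ ^ e := Real.rpow_nonneg hκ.le e
  have hc2 : 0 ≤ A * c ^ (2 * β) := mul_nonneg hA (Real.rpow_nonneg hc.le _)
  calc A * (c ^ (2 * β) * (κ ^ e * κ ^ ((1 - α) * γ))) + B * (c ^ (α + 2 * β - 1) * κ ^ e) +
        D * (c ^ (2 * β - 2) * κ ^ e)
      = (A * c ^ (2 * β) * κ ^ ((1 - α) * γ) + B * c ^ (α + 2 * β - 1) + D * c ^ (2 * β - 2)) * κ ^ e := by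
        ring
    _ ≤ (A * c ^ (2 * β) * κ₀ ^ ((1 - α) * γ) + B * c ^ (α + 2 * β - 1) + D * c ^ (2 * β - 2)) * κ ^ e := by
        gcongr
    _ = _ := by ring

/-! ## The dissipation bound at a fixed mollification scale -/

/-- **The printed bound (5.10) at `t = 0`, before optimisation in `ℓ`** (DEIJ 2022, proof of
Thm. 4): under the hypotheses of the named fact for one solution (`u ∈ L¹C^α` with
`‖u‖_{L¹C^α} ≤ K`, `‖θ₀‖_{C^β} ≤ M`, energy balance, `ess sup ‖θ(t)‖_{C^β} ≤ M`) and a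
mollification scale `0 < ε ≤ 1/4`,
`2κ ∫₀ᵀ ‖∇θ‖²_{L²} ≤ M² ε^{2β} + 2 (2 d C₁ M² ε^{α+2β-1} K + T κ d C₁² M² ε^{2β-2})`,
`C₁ = Torus.gradProfileMass d`, `d = card d`. [cite: DrivasEtAl2022, proof of Thm. 4, (5.9)–(5.10)] -/
theorem DrivasElgindiIyerJeong2022_thm4.two_mul_eScalarDissipation_le {d : Type*} [Fintype d]
    [DecidableEq d] {T : ℝ} (hT : 0 < T) {α β : ℝ≥0} (hβ : 0 < β) {K M : ℝ≥0}
    {u : ℝ → UnitAddTorus d → EuclideanSpace ℝ d} (hu : MemLpHolder 1 α u (Ioo 0 T))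
    (huK : eLpHolderNorm 1 α u (Ioo 0 T) ≤ K) {θ₀ : UnitAddTorus d → ℝ}
    (hθ₀ : eBoundedHolderNorm β θ₀ ≤ M) {κ : ℝ} (hκ : 0 < κ) {θ : ℝ → UnitAddTorus d → ℝ}
    (hθ : Torus.IsWeakScalarTransportOn T κ u θ₀ θ)
    (henergy : ∀ᵐ t ∂((volume : Measure ℝ).restrict (Ioo 0 T)),
      (∫⁻ x, ‖θ t x‖ₑ ^ 2) + 2 * Torus.eScalarDissipation κ θ 0 t ≤ ∫⁻ x, ‖θ₀ x‖ₑ ^ 2)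
    (hbound : ∀ᵐ t ∂((volume : Measure ℝ).restrict (Ioo 0 T)), eBoundedHolderNorm β (θ t) ≤ M)
    {ε : ℝ} (hε : 0 < ε) (hε' : ε ≤ 1 / 4) :
    2 * Torus.eScalarDissipation κ θ 0 T ≤ ENNReal.ofReal
      ((M : ℝ) ^ 2 * ε ^ (2 * (β : ℝ)) +
        2 * ((2 * Fintype.card d * Torus.gradProfileMass d * (M : ℝ) ^ 2 * ε ^ ((α : ℝ) + 2 * β - 1)) * K +
          T * (κ * (Fintype.card d * (Torus.gradProfileMass d ^ 2 * (M : ℝ) ^ 2 * ε ^ (2 * (β : ℝ) - 2)))))) := by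
  -- the datum
  have hMtop : ((M : ℝ≥0∞)) < ⊤ := ENNReal.coe_lt_top
  have nn_le : ∀ {f : UnitAddTorus d → ℝ}, eBoundedHolderNorm β f ≤ M → HolderWith M β f ∧ Continuous f := by
    intro f hf
    have hB : MemBoundedHolder β f := lt_of_le_of_lt hf hMtop
    refine ⟨Torus.holderWith_of_nnHolderNorm_le hB.memHolder (ENNReal.coe_le_coe.1 ?_), hB.continuous hβ⟩
    rw [hB.memHolder.coe_nnHolderNorm_eq_eHolderNorm]
    exact (eHolderNorm_le_eBoundedHolderNorm β f).trans hf
  have hθ₀H : HolderWith M β θ₀ := (nn_le hθ₀).1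
  have hθ₀c : Continuous θ₀ := (nn_le hθ₀).2
  have hθ₀i : Integrable θ₀ volume := hθ₀c.integrable_unitAddTorus
  set k : UnitAddTorus d → ℝ := Torus.kernel ε with hk_def
  have hk : Torus.IsSmooth k := Torus.isSmooth_kernel hε hε'
  -- constants and exponent bookkeeping
  set C₁ : ℝ := Torus.gradProfileMass d with hC₁
  have hC₁0 : 0 ≤ C₁ := Torus.gradProfileMass_nonneg
  set c₁ : ℝ := 2 * Fintype.card d * C₁ * (M : ℝ) ^ 2 * ε ^ ((α : ℝ) + 2 * β - 1) with hc₁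
  set c₂ : ℝ := κ * (Fintype.card d * (C₁ ^ 2 * (M : ℝ) ^ 2 * ε ^ (2 * (β : ℝ) - 2))) with hc₂
  have hc₁0 : 0 ≤ c₁ := by positivity
  have hc₂0 : 0 ≤ c₂ := by positivity
  have i1 : ((M : ℝ) * ε ^ (β : ℝ)) ^ 2 = (M : ℝ) ^ 2 * ε ^ (2 * (β : ℝ)) := by
    rw [mul_pow, ← Real.rpow_natCast (ε ^ (β : ℝ)) 2, ← Real.rpow_mul hε.le]
    congr 2
    push_cast
    ring
  have i2 : ε⁻¹ * ε ^ (β : ℝ) * ε ^ (α : ℝ) * ε ^ (β : ℝ) = ε ^ ((α : ℝ) + 2 * β - 1) := by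
    rw [← Real.rpow_neg_one ε, ← Real.rpow_add hε, ← Real.rpow_add hε, ← Real.rpow_add hε]
    congr 1
    ring
  have i3 : (ε⁻¹ * ε ^ (β : ℝ)) ^ 2 = ε ^ (2 * (β : ℝ) - 2) := by
    rw [← Real.rpow_neg_one ε, ← Real.rpow_add hε, ← Real.rpow_natCast _ 2, ← Real.rpow_mul hε.le]
    congr 1
    push_cast
    ring
  -- Step 1: the slice bound, for a.e. `s`
  have hslice : ∀ᵐ s ∂((volume : Measure ℝ).restrict (Ioo 0 T)),
      -(∫ x, ((θ s) ⋆ k) x * ∫ y, θ s y *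
        (-⟪u s y, Torus.gradient k (x - y)⟫_ℝ + κ * Torus.laplacian k (x - y))) ≤
        c₁ * boundedHolderNorm α (u s) + c₂ := by
    filter_upwards [hbound, hu.1, hθ.ae_isWeaklyDivFree, hθ.ae_aestronglyMeasurable_velocity_slice]
      with s hsM hsu hdiv hum
    have hθsH : HolderWith M β (θ s) := (nn_le hsM).1
    have hθsc : Continuous (θ s) := (nn_le hsM).2
    have huH : HolderWith (nnHolderNorm α (u s)) α (u s) := hsu.memHolder.holderWith
    have hCv : ∀ y, ‖u s y‖ ≤ (eSupNorm (u s)).toReal := fun y => by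
      rw [← toReal_enorm]
      exact ENNReal.toReal_mono hsu.eSupNorm_lt_top.ne (enorm_le_eSupNorm (u s) y)
    have hle : ((nnHolderNorm α (u s) : ℝ≥0) : ℝ) ≤ boundedHolderNorm α (u s) :=
      ENNReal.toReal_mono hsu.ne (eHolderNorm_le_eBoundedHolderNorm α (u s))
    have h := Torus.neg_integral_conv_mul_flux_le_of_holderWith hθsc hθsH hum hCv huH hdiv hε hε' hκ.le
    have hn0 : 0 ≤ ((nnHolderNorm α (u s) : ℝ≥0) : ℝ) := NNReal.coe_nonneg _
    calc _ ≤ _ := h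
      _ = c₁ * ((nnHolderNorm α (u s) : ℝ≥0) : ℝ) + c₂ := by
          rw [hc₁, hc₂, ← i2, ← i3]
          ring
      _ ≤ c₁ * boundedHolderNorm α (u s) + c₂ := by gcongr
  -- Step 2: the time integral of the slice bound, in `ℝ≥0∞`
  have hKint : ∫⁻ s in Ioo 0 T, ENNReal.ofReal (boundedHolderNorm α (u s)) ≤ K := by
    have e : ∫⁻ s in Ioo 0 T, ENNReal.ofReal (boundedHolderNorm α (u s)) = eLpHolderNorm 1 α u (Ioo 0 T) := by
      rw [eLpHolderNorm, eLpNorm_one_eq_lintegral_enorm]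
      refine lintegral_congr fun s => ?_
      exact (Real.enorm_eq_ofReal ENNReal.toReal_nonneg).symm
    rw [e]
    exact huK
  have htime : ∀ t ∈ Ioo 0 T,
      ENNReal.ofReal (∫ s in Ioc 0 t, -(∫ x, ((θ s) ⋆ k) x * ∫ y, θ s y *
        (-⟪u s y, Torus.gradient k (x - y)⟫_ℝ + κ * Torus.laplacian k (x - y)))) ≤
        ENNReal.ofReal c₁ * K + ENNReal.ofReal c₂ * ENNReal.ofReal T := by
    intro t ht
    refine (ofReal_integral_le_lintegral_ofReal _).trans ?_
    refine (lintegral_mono_set (Ioc_subset_Ioo_right ht.2)).trans ?_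
    have hmono : ∫⁻ s in Ioo 0 T, ENNReal.ofReal (-(∫ x, ((θ s) ⋆ k) x * ∫ y, θ s y *
        (-⟪u s y, Torus.gradient k (x - y)⟫_ℝ + κ * Torus.laplacian k (x - y)))) ≤
        ∫⁻ s in Ioo 0 T, (ENNReal.ofReal c₁ * ENNReal.ofReal (boundedHolderNorm α (u s)) + ENNReal.ofReal c₂) := by
      refine lintegral_mono_ae (hslice.mono fun s hs => ?_)
      have hb0 : 0 ≤ boundedHolderNorm α (u s) := ENNReal.toReal_nonneg
      rw [← ENNReal.ofReal_mul hc₁0, ← ENNReal.ofReal_add (mul_nonneg hc₁0 hb0) hc₂0]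
      exact ENNReal.ofReal_le_ofReal hs
    refine hmono.trans ?_
    rw [lintegral_add_right _ measurable_const, lintegral_const_mul' _ _ ENNReal.ofReal_ne_top,
      lintegral_const, Measure.restrict_apply_univ, Real.volume_Ioo, sub_zero]
    gcongr
  -- Step 3: the bound for a.e. `t`
  have hmain : ∀ᵐ t ∂((volume : Measure ℝ).restrict (Ioo 0 T)), 2 * Torus.eScalarDissipation κ θ 0 t ≤
      ENNReal.ofReal ((M : ℝ) ^ 2 * ε ^ (2 * (β : ℝ))) + 2 * (ENNReal.ofReal c₁ * K + ENNReal.ofReal c₂ * ENNReal.ofReal T) := by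
    filter_upwards [henergy, hθ.ae_integral_sq_molInt_eq hθ₀i hk, ae_restrict_mem measurableSet_Ioo,
      hθ.ae_slice_integrable₁] with t hen hid htT hint
    have hθti : Integrable (θ t) volume := hint.1
    have hAc : Continuous ((θ t) ⋆ k) := Torus.continuous_convolution hθti hk.continuous
    -- Young: `‖θ(t) ⋆ k‖₂ ≤ ‖θ(t)‖₂`
    have hY : ∫⁻ x, ‖((θ t) ⋆ k) x‖ₑ ^ 2 ≤ ∫⁻ x, ‖θ t x‖ₑ ^ 2 := by
      rw [← PassiveScalarProofs.eLpNorm_two_pow_two, ← PassiveScalarProofs.eLpNorm_two_pow_two]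
      gcongr
      calc eLpNorm ((θ t) ⋆ k) 2 volume ≤ (∫⁻ y, ‖k y‖ₑ) * eLpNorm (θ t) 2 volume :=
            Torus.eLpNorm_convolution_le hθti.aestronglyMeasurable hk.continuous.aestronglyMeasurable one_le_two
        _ = eLpNorm (θ t) 2 volume := by rw [hk_def, Torus.lintegral_enorm_kernel hε hε', one_mul]
    have e0 : ∫⁻ x, ‖θ₀ x‖ₑ ^ 2 = ENNReal.ofReal (∫ x, θ₀ x ^ 2) :=
      Torus.lintegral_enorm_sq_eq_ofReal_integral_sq hθ₀c
    have eA : ∫⁻ x, ‖((θ t) ⋆ k) x‖ₑ ^ 2 = ENNReal.ofReal (∫ x, ((θ t) ⋆ k) x ^ 2) :=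
      Torus.lintegral_enorm_sq_eq_ofReal_integral_sq hAc
    have h1 : ENNReal.ofReal (∫ x, ((θ t) ⋆ k) x ^ 2) + 2 * Torus.eScalarDissipation κ θ 0 t ≤
        ENNReal.ofReal (∫ x, θ₀ x ^ 2) := by
      rw [← eA, ← e0]
      exact (add_le_add hY le_rfl).trans hen
    have h2 : 2 * Torus.eScalarDissipation κ θ 0 t ≤
        ENNReal.ofReal ((∫ x, θ₀ x ^ 2) - ∫ x, ((θ t) ⋆ k) x ^ 2) := by
      rw [ENNReal.ofReal_sub _ (integral_nonneg fun x => sq_nonneg _)]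
      exact ENNReal.le_sub_of_add_le_left ENNReal.ofReal_ne_top h1
    have h3 : (∫ x, θ₀ x ^ 2) - ∫ x, ((θ t) ⋆ k) x ^ 2 ≤ (M : ℝ) ^ 2 * ε ^ (2 * (β : ℝ)) +
        2 * ∫ s in Ioc 0 t, -(∫ x, ((θ s) ⋆ k) x * ∫ y, θ s y *
          (-⟪u s y, Torus.gradient k (x - y)⟫_ℝ + κ * Torus.laplacian k (x - y))) := by
      rw [hid, integral_neg, ← i1]
      have := Torus.integral_sq_sub_integral_convolution_sq_le hθ₀c hθ₀H hε hε'
      linarith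
    calc 2 * Torus.eScalarDissipation κ θ 0 t
        ≤ ENNReal.ofReal ((∫ x, θ₀ x ^ 2) - ∫ x, ((θ t) ⋆ k) x ^ 2) := h2
      _ ≤ ENNReal.ofReal ((M : ℝ) ^ 2 * ε ^ (2 * (β : ℝ)) +
          2 * ∫ s in Ioc 0 t, -(∫ x, ((θ s) ⋆ k) x * ∫ y, θ s y *
            (-⟪u s y, Torus.gradient k (x - y)⟫_ℝ + κ * Torus.laplacian k (x - y)))) :=
          ENNReal.ofReal_le_ofReal h3
      _ ≤ ENNReal.ofReal ((M : ℝ) ^ 2 * ε ^ (2 * (β : ℝ))) +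
          ENNReal.ofReal (2 * ∫ s in Ioc 0 t, -(∫ x, ((θ s) ⋆ k) x * ∫ y, θ s y *
            (-⟪u s y, Torus.gradient k (x - y)⟫_ℝ + κ * Torus.laplacian k (x - y)))) :=
          ENNReal.ofReal_add_le
      _ ≤ _ := by
          rw [ENNReal.ofReal_mul zero_le_two, ENNReal.ofReal_ofNat]
          gcongr
          exact htime t htT
  -- Step 4: from a.e. `t` to `T`
  have h2D : ∀ t, 2 * Torus.eScalarDissipation κ θ 0 t =
      ∫⁻ s in Ioo 0 t, 2 * (ENNReal.ofReal κ * Torus.eScalarGradNormSq (θ s)) := fun t => by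
    rw [Torus.eScalarDissipation, ← lintegral_const_mul' _ _ ENNReal.ofReal_ne_top,
      ← lintegral_const_mul' _ _ ENNReal.ofNat_ne_top]
  have hfin : 2 * Torus.eScalarDissipation κ θ 0 T ≤
      ENNReal.ofReal ((M : ℝ) ^ 2 * ε ^ (2 * (β : ℝ))) + 2 * (ENNReal.ofReal c₁ * K + ENNReal.ofReal c₂ * ENNReal.ofReal T) := by
    rw [h2D]
    refine setLIntegral_Ioo_le_of_ae_le hT ?_
    filter_upwards [hmain] with t ht
    rwa [h2D] at ht
  refine hfin.trans (le_of_eq ?_)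
  rw [ENNReal.ofReal_add (by positivity) (by positivity), ENNReal.ofReal_mul zero_le_two, ENNReal.ofReal_ofNat,
    ENNReal.ofReal_add (by positivity) (by positivity), ENNReal.ofReal_mul hc₁0, ENNReal.ofReal_coe_nnreal,
    ENNReal.ofReal_mul (le_of_lt hT), mul_comm (ENNReal.ofReal T) (ENNReal.ofReal c₂)]

/-! ## The theorem -/

/-- **Discharge of `DrivasElgindiIyerJeong2022_thm4`** (Drivas–Elgindi–Iyer–Jeong, ARMA 243
(2022), Thm. 4, first assertion: `κ ∫₀ᵀ∫|∇θ^κ|² ≤ C κ^{(α+2β-1)/(α+1)}` for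
`u ∈ L¹(0,T;C^α)`, `θ^κ` bounded in `L^∞(0,T;C^β)`, "for an absolute constant `C` depending
only on `T` and the Hölder norms of the solutions"). The constant produced is
`C = ½ M² (c^{2β} κ₀^{(1-α)/(α+1)} + 4 d C₁ K c^{α+2β-1} + 2 d C₁² T c^{2β-2})`,
`c = ¼ κ₀^{-1/(α+1)}`, from `two_mul_eScalarDissipation_le` at the scale `ε = c κ^{1/(α+1)}`
(`scale_bound`); for `κ₀ = 0` the range `0 < κ ≤ κ₀` is empty. [cite: DrivasEtAl2022, Thm. 4] -/
theorem DrivasElgindiIyerJeong2022_thm4_holds : DrivasElgindiIyerJeong2022_thm4 := by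
  intro d _ _ T hT α β hα hβ K M κ₀
  rcases eq_zero_or_pos κ₀ with hκ₀ | hκ₀
  · refine ⟨0, ?_⟩
    intro u _ _ θ₀ _ κ hκ hκκ₀
    exact absurd (hκ.trans_le hκκ₀) (by simp [hκ₀])
  -- the scale `ε = c κ^γ`
  set γ : ℝ := ((α : ℝ) + 1)⁻¹ with hγ
  have hα1pos : (0 : ℝ) < α + 1 := by positivity
  have hγ0 : 0 ≤ γ := by positivity
  have hκ₀' : (0 : ℝ) < κ₀ := hκ₀
  set c : ℝ := 4⁻¹ * (κ₀ : ℝ) ^ (-γ) with hc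
  have hc0 : 0 < c := by positivity
  set C₁ : ℝ := Torus.gradProfileMass d with hC₁
  have hC₁0 : 0 ≤ C₁ := Torus.gradProfileMass_nonneg
  set Cr : ℝ := 2⁻¹ * ((M : ℝ) ^ 2 * (c ^ (2 * (β : ℝ)) * (κ₀ : ℝ) ^ ((1 - (α : ℝ)) * γ)) +
      (2 * (2 * Fintype.card d * C₁ * (M : ℝ) ^ 2) * K) * c ^ ((α : ℝ) + 2 * β - 1) +
      (2 * (T * (Fintype.card d * (C₁ ^ 2 * (M : ℝ) ^ 2)))) * c ^ (2 * (β : ℝ) - 2)) with hCr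
  have hCr0 : 0 ≤ Cr := by positivity
  refine ⟨Cr.toNNReal, ?_⟩
  intro u hu huK θ₀ hθ₀ κ hκ hκκ₀ θ hθ henergy hbound
  set ε : ℝ := c * κ ^ γ with hε_def
  have hε : 0 < ε := by positivity
  have hε' : ε ≤ 1 / 4 := by
    have h1 : κ ^ γ ≤ (κ₀ : ℝ) ^ γ := Real.rpow_le_rpow hκ.le (by exact_mod_cast hκκ₀) hγ0
    have h2 : (κ₀ : ℝ) ^ (-γ) * (κ₀ : ℝ) ^ γ = 1 := by
      rw [Real.rpow_neg hκ₀'.le, inv_mul_cancel₀ (Real.rpow_pos_of_pos hκ₀' γ).ne']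
    calc ε = 4⁻¹ * ((κ₀ : ℝ) ^ (-γ) * κ ^ γ) := by rw [hε_def, hc, mul_assoc]
      _ ≤ 4⁻¹ * ((κ₀ : ℝ) ^ (-γ) * (κ₀ : ℝ) ^ γ) := by gcongr
      _ = 1 / 4 := by rw [h2]; norm_num
  have hraw := DrivasElgindiIyerJeong2022_thm4.two_mul_eScalarDissipation_le hT hβ.1 hu huK hθ₀ hκ hθ
    henergy hbound hε hε'
  -- optimisation in `ℓ`
  have hscale := scale_bound (β := (β : ℝ)) (2 * (2 * Fintype.card d * C₁ * (M : ℝ) ^ 2) * K)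
    (2 * (T * (Fintype.card d * (C₁ ^ 2 * (M : ℝ) ^ 2)))) (by exact_mod_cast hα.2) hα1pos hκ
    (by exact_mod_cast hκκ₀) hc0 hγ (sq_nonneg (M : ℝ))
  have hreal : (M : ℝ) ^ 2 * ε ^ (2 * (β : ℝ)) +
      2 * ((2 * Fintype.card d * C₁ * (M : ℝ) ^ 2 * ε ^ ((α : ℝ) + 2 * β - 1)) * K +
        T * (κ * (Fintype.card d * (C₁ ^ 2 * (M : ℝ) ^ 2 * ε ^ (2 * (β : ℝ) - 2))))) ≤
      2 * ((Cr.toNNReal : ℝ≥0) * κ ^ (((α : ℝ) + 2 * β - 1) / (α + 1))) := by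
    rw [Real.coe_toNNReal _ hCr0, hCr]
    calc _ = (M : ℝ) ^ 2 * (c * κ ^ γ) ^ (2 * (β : ℝ)) +
          2 * (2 * Fintype.card d * C₁ * (M : ℝ) ^ 2) * K * (c * κ ^ γ) ^ ((α : ℝ) + 2 * β - 1) +
          2 * (T * (Fintype.card d * (C₁ ^ 2 * (M : ℝ) ^ 2))) * (κ * (c * κ ^ γ) ^ (2 * (β : ℝ) - 2)) := by
          rw [hε_def]; ring
      _ ≤ _ := hscale
      _ = _ := by ring
  calc Torus.eScalarDissipation κ θ 0 T
      ≤ 2⁻¹ * (2 * Torus.eScalarDissipation κ θ 0 T) := by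
        rw [← mul_assoc, ENNReal.inv_mul_cancel two_ne_zero ENNReal.ofNat_ne_top, one_mul]
    _ ≤ 2⁻¹ * ENNReal.ofReal (2 * ((Cr.toNNReal : ℝ≥0) * κ ^ (((α : ℝ) + 2 * β - 1) / (α + 1)))) := by
        gcongr
        exact hraw.trans (ENNReal.ofReal_le_ofReal hreal)
    _ = ENNReal.ofReal ((Cr.toNNReal : ℝ≥0) * κ ^ (((α : ℝ) + 2 * β - 1) / (α + 1))) := by
        rw [ENNReal.ofReal_mul zero_le_two, ENNReal.ofReal_ofNat, ← mul_assoc,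
          ENNReal.inv_mul_cancel two_ne_zero ENNReal.ofNat_ne_top, one_mul]

/-! ## Addendum (barrier audit 2026-08-17, gen 18): the `κ₀`-free form on and above the line -/

/-- **On and above the Obukhov–Corrsin line the range restriction `κ ≤ κ₀` is cosmetic**
(barrier audit 2026-08-17, gen 18; sharpening of scope caveat (iv) of
`DrivasElgindiIyerJeong2022_thm4`): for `1 ≤ α + 2β` the exponent `(α+2β-1)/(α+1)` is
non-negative, while the energy hypothesis (1.2) alone gives `κ∫₀ᵀ‖∇θ‖²₂ ≤ ½‖θ₀‖²₂ ≤ ½M²`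
(`‖θ₀‖_∞ ≤ ‖θ₀‖_{C^{0,β}} ≤ M`, unit volume), which is at most `½M²κ^{(α+2β-1)/(α+1)}` for
`κ ≥ 1`; hence ONE constant `C = C(d, T, α, β, K, M)` serves EVERY `κ > 0` (the named fact at
`κ₀ = 1` below `κ = 1`, the trivial bound above). Below the line the dependence of `C` on `κ₀` is
genuine — heat flows, caveat (iv) — so the printed "`{θ^κ}_{κ>0}`" needs no range proviso exactly in
the regime `α + 2β ≥ 1` where Thm. 4 has content. [cite: DrivasEtAl2022, Thm. 4] -/
theorem DrivasElgindiIyerJeong2022_thm4_allKappa (d : Type) [Fintype d] [DecidableEq d]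
    (T : ℝ) (hT : 0 < T) (α β : ℝ≥0) (hα : 0 < α ∧ α ≤ 1) (hβ : 0 < β ∧ β ≤ 1)
    (hline : 1 ≤ (α : ℝ) + 2 * β) (K M : ℝ≥0) :
    ∃ C : ℝ≥0,
      ∀ (u : ℝ → UnitAddTorus d → EuclideanSpace ℝ d) (_hu : MemLpHolder 1 α u (Ioo 0 T))
        (_huK : eLpHolderNorm 1 α u (Ioo 0 T) ≤ K)
        (θ₀ : UnitAddTorus d → ℝ) (_hθ₀ : eBoundedHolderNorm β θ₀ ≤ M)
        (κ : ℝ) (_hκ : 0 < κ)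
        (θ : ℝ → UnitAddTorus d → ℝ) (_hθ : Torus.IsWeakScalarTransportOn T κ u θ₀ θ)
        (_henergy : ∀ᵐ t ∂(volume.restrict (Ioo 0 T)),
          (∫⁻ x, ‖θ t x‖ₑ ^ 2) + 2 * Torus.eScalarDissipation κ θ 0 t ≤ ∫⁻ x, ‖θ₀ x‖ₑ ^ 2)
        (_hbound : ∀ᵐ t ∂(volume.restrict (Ioo 0 T)), eBoundedHolderNorm β (θ t) ≤ M),
        Torus.eScalarDissipation κ θ 0 T ≤
          ENNReal.ofReal (C * κ ^ (((α : ℝ) + 2 * β - 1) / (α + 1))) := by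
  obtain ⟨C, hC⟩ := DrivasElgindiIyerJeong2022_thm4_holds d T hT α β hα hβ K M 1
  refine ⟨C + M ^ 2, fun u hu huK θ₀ hθ₀ κ hκ θ hθ henergy hbound => ?_⟩
  set e : ℝ := ((α : ℝ) + 2 * β - 1) / (α + 1) with he
  have he0 : 0 ≤ e := div_nonneg (by linarith) (by positivity)
  have hκe : 0 ≤ κ ^ e := Real.rpow_nonneg hκ.le e
  rcases le_or_gt κ 1 with hκ1 | hκ1
  · -- `κ ≤ 1`: the named fact at `κ₀ = 1`, then monotonicity of the constant
    refine (hC u hu huK θ₀ hθ₀ κ hκ (by exact_mod_cast hκ1) θ hθ henergy hbound).trans ?_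
    refine ENNReal.ofReal_le_ofReal (mul_le_mul_of_nonneg_right ?_ hκe)
    push_cast
    nlinarith [sq_nonneg (M : ℝ)]
  · -- `κ > 1`: the trivial bound `κ∫‖∇θ‖² ≤ ½‖θ₀‖²₂ ≤ M²`
    -- the datum: `∫ θ₀² ≤ M²`
    have hθ₀2 : ∫⁻ x, ‖θ₀ x‖ₑ ^ 2 ≤ (M : ℝ≥0∞) ^ 2 := by
      have hpt : ∀ x, ‖θ₀ x‖ₑ ^ 2 ≤ (M : ℝ≥0∞) ^ 2 := fun x => by
        gcongr
        exact (enorm_le_eSupNorm θ₀ x).trans ((eSupNorm_le_eBoundedHolderNorm β θ₀).trans hθ₀)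
      calc ∫⁻ x, ‖θ₀ x‖ₑ ^ 2 ≤ ∫⁻ _x : UnitAddTorus d, (M : ℝ≥0∞) ^ 2 := lintegral_mono hpt
        _ = (M : ℝ≥0∞) ^ 2 := by rw [lintegral_const, measure_univ, mul_one]
    -- from a.e. `t` to `T`
    have h2D : ∀ t, 2 * Torus.eScalarDissipation κ θ 0 t =
        ∫⁻ s in Ioo 0 t, 2 * (ENNReal.ofReal κ * Torus.eScalarGradNormSq (θ s)) := fun t => by
      rw [Torus.eScalarDissipation, ← lintegral_const_mul' _ _ ENNReal.ofReal_ne_top,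
        ← lintegral_const_mul' _ _ ENNReal.ofNat_ne_top]
    have hfin : 2 * Torus.eScalarDissipation κ θ 0 T ≤ (M : ℝ≥0∞) ^ 2 := by
      rw [h2D]
      refine setLIntegral_Ioo_le_of_ae_le hT ?_
      filter_upwards [henergy] with t ht
      rw [← h2D]
      exact (le_add_self.trans ht).trans hθ₀2
    have hD : Torus.eScalarDissipation κ θ 0 T ≤ (M : ℝ≥0∞) ^ 2 :=
      (le_mul_of_one_le_left bot_le one_le_two).trans hfin
    refine hD.trans ?_
    -- `M² ≤ (C + M²) κ^e` for `κ ≥ 1`, `e ≥ 0`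
    have h1 : (1 : ℝ) ≤ κ ^ e := Real.one_le_rpow hκ1.le he0
    have hM : ((M : ℝ≥0∞)) ^ 2 = ENNReal.ofReal ((M : ℝ) ^ 2) := by
      rw [ENNReal.ofReal_pow (NNReal.coe_nonneg M), ENNReal.ofReal_coe_nnreal]
    rw [hM]
    refine ENNReal.ofReal_le_ofReal ?_
    push_cast
    have hC0 : (0 : ℝ) ≤ C := NNReal.coe_nonneg C
    nlinarith [sq_nonneg (M : ℝ), mul_nonneg hC0 hκe]

end Literature.Barriers.AnomalousDissipation

end
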